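import Summits.QuantumFields.YangMills.Theorems.DiagonalMirrorRPRWilsonDiagonalModelOddTorus
import Summits.QuantumFields.YangMills.Theorems.DiagonalMirrorRPRWilsonDiagonalModelHalfSteps
import Literature.MathematicalPhysics.QuantumFieldTheory.LatticeGaugeStaticPotentialProofs
import Literature.RepresentationTheory.CompactGroups.UnitaryTrick

/-!
# Crux `DiagonalMirrorRPR` (stmt-QuantumFields-10604), line `sign-twisted-diagonal-trace`, construction F1_diag
# (director-ym O4 WORD 3 (A)): Wilson's measure on the odd torus as the cyclic chain of the symmetric-chart kernel;
# the FIBREWISE swap, the two half steps and their Θ-pseudo-symmetry (kernel level of `Â = 𝒜Θ`, `B̂ = Θ𝓑`)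

Helper for the crux `DiagonalMirrorRPR` of `YangMills` (routes `IsotropyFromPowerCounting`, `MirrorModularBoosts`,
`PencilRigidity`; item stmt-QuantumFields-10604), attached `--supports … --as helper`; it closes nothing by itself.
Continuation of `…Theorems.DiagonalMirrorRPRWilsonDiagonalModelOddTorus` (symmetric chart `lcSite/lcInv`, layers
`layerReadU`, `layerEquivU hS`, kernel `stepKernelU ρ β`).

* §10 `diagCyclicTraceU ρ β m = ∫ ∏_{t : ℤ_m} K_u(Z_t, Z_{t+1}) dHaar` — the core's "`Tr A_k^m`" (a twisted diagonal-torus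
  partition function) — **non-negative for every `m`** (`diagCyclicTraceU_nonneg`: positive integrand; this is the
  interface field `trace_nonneg` at kernel level) and **positive for `m = S`** (`diagCyclicTraceU_side_pos`; field
  `trace_side_pos`); `measurePreserving_layerEquivU`; **`integral_mul_exp_neg_mul_wilsonAction_eq`**,
  `integral_exp_neg_mul_wilsonAction_eq` (`∫ exp(−βS) = exp(−β N_c #plaq) · Tr K_u^S`),
  **`integral_wilsonMeasure_eq_diagCyclicU`** and **`latticeSchwinger_eq_diagCyclicU`** (the scheme's torus has odd side
  `2L_k+1`: `Odd (sch.side k)` is `⟨sch.L k, rfl⟩`).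
* §11 THE SWAP IS FIBREWISE: `lcSite_sitePerm_swap` (`(v,u) ↦ (−v,u)`), `sitePerm_swap_lcInv`; on layers
  **`inslab_layerReadU_swap`** (`X_v(swap U) = X_{−v}(U)`) and **`bonds_layerReadU_swap`**
  (`Y(Z_v(swap U)) = Θ Y(Z_{1−v}(U))`, `Θ = thetaHalf` = bond-label involution `0 ↔ 1`, NO slab shift); the half steps
  `evenActionU` / `oddActionU` with **`stepActionU_eq_even_add_odd`**, `stepKernelU_eq_even_mul_odd`; the
  Θ-PSEUDO-SYMMETRIES **`oddActionU_reverse`** (`odd(X', ΘY', X) = odd(X, Y', X')`, exact) and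
  **`evenActionU_reverse`** (`even(ΘY″, X, ΘY) = even(Y, X, Y″)`; the reversed diamond is the inverse holonomy and
  `Re tr ρ(g⁻¹) = Re tr ρ(g)`, `CompactGroup.re_trace_map_inv`) — the card's `𝒜ᵀ = Θ𝒜Θ`, `𝓑ᵀ = Θ𝓑Θ` at kernel level —
  and the SCHUR-CUT form **`evenActionU_thetaHalf`**: `even(Y, X, ΘY″) = Σ_u Re tr ρ(D_u(Y″) D_u(Y)⁻¹) + (in-slab)`,
  `D_u(W) = W(u,1) W(u+1,0)` (`diamond`), whence `exp(β · even(Y,X,ΘY″))` is of positive type for `β ≥ 0`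
  (`Literature/Analysis/OperatorTheory/ExpInnerProductKernelPositivity`; the operator statement `Ê ⪰ 0` is OWED).
  Swap invariance of the MEASURE is the tree's `wilsonMeasure_map_configPerm`.

OWED (see ROADMAP-F1diag.md on the item): `E_op/O_op` as bounded operators between the two pair spaces, `Ê = E J`,
`Ô = J* O` self-adjoint, `Ê ⪰ 0`, `A = Ê^{1/2} Ô Ê^{1/2}` Hilbert–Schmidt with `Σ λ_j^m = diagCyclicTraceU … m`, and the
`famObs` pairing layer; no `def wilsonDiagonalModel : DiagonalSliceModel r sch` yet.  HONEST FRAMING: a construction helper;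
nothing about D_old ⟨10604⟩, the RP crux of the FOLD restate, or the summit is proved; the Yang–Mills mass gap is NOT proved
here or anywhere in the tree.

References: K. Osterwalder, E. Seiler, Ann. Phys. 110 (1978) §2–3; E. Seiler, LNP 159 (1982) Ch. 2.
-/

set_option autoImplicit false

noncomputable section

open MeasureTheory
open Literature.MathematicalPhysics.QuantumLattice Literature.MathematicalPhysics.QuantumFieldTheory
open Summit.QuantumFields.YangMills.Cruxes.DiagonalMirrorRPR.ParityBridgeColdTraces

namespace Summit.QuantumFields.YangMills.Cruxes.DiagonalMirrorRPR.SignTwistedDiagonalTrace.WilsonDiagonal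

/-! ## §10 Wilson's measure on the odd torus as the cyclic chain of the symmetric-chart kernel -/

section UCyclic

variable {S : ℕ} [NeZero S]
variable {G : Type} [Group G] [TopologicalSpace G] [IsTopologicalGroup G] [CompactSpace G] [MeasurableSpace G]
  [BorelSpace G] {Nc : ℕ} (ρ : G →* Matrix (Fin Nc) (Fin Nc) ℂ) (β : ℝ)

/-- **The cyclic trace of the symmetric-chart kernel over `m` layers** — for `m = S` Wilson's partition function of the
odd torus up to the constant `exp(−β N_c #plaquettes)` (`integral_exp_neg_mul_wilsonAction_eq`); for general `m` the
core's "`Tr A_k^m`", a twisted diagonal-torus partition function, NON-NEGATIVE by construction (`diagCyclicTraceU_nonneg`). -/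
def diagCyclicTraceU (m : ℕ) [NeZero m] : ℝ :=
  ∫ Z : ZMod m → LayerCfg S S G, ∏ t : ZMod m, stepKernelU ρ β (Z t) (Z (t + 1))
    ∂(Measure.pi fun _ : ZMod m => layerHaar S S G)

/-- `Tr A^m ≥ 0` at kernel level: the cyclic trace of a positive kernel is non-negative. -/
theorem diagCyclicTraceU_nonneg (m : ℕ) [NeZero m] : 0 ≤ diagCyclicTraceU (S := S) (G := G) ρ β m :=
  integral_nonneg fun Z => Finset.prod_nonneg fun t _ => (stepKernelU_pos ρ β (Z t) (Z (t + 1))).le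

/-- **The symmetric-chart layer equivalence preserves product Haar measure** (odd `S`). -/
theorem measurePreserving_layerEquivU (hS : Odd S) :
    MeasurePreserving (layerEquivU hS : GaugeConfig 4 S G ≃ᵐ (ZMod S → LayerCfg S S G))
      (Measure.pi fun _ : Literature.MathematicalPhysics.QuantumFieldTheory.Edge 4 S => haarProbability G)
      (Measure.pi fun _ : ZMod S => layerHaar S S G) := by
  unfold layerEquivU layerHaar
  exact (measurePreserving_piCongrLeft (μ := fun _ : ZMod S × LayerIdx S S => haarProbability G)
    (lcEdgeEquiv hS)).trans (measurePreserving_curry_haar (ZMod S) (LayerIdx S S))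

/-- **Boltzmann integrals of the odd torus as cyclic integrals of the symmetric-chart kernel**:
`∫ F exp(−β S) dHaar = exp(−β N_c #plaq) ∫ F(assembled layers) ∏_v K_u(Z_v, Z_{v+1}) dHaar`. -/
theorem integral_mul_exp_neg_mul_wilsonAction_eq (hS : Odd S) (F : GaugeConfig 4 S G → ℝ) :
    ∫ U, F U * Real.exp (-β * wilsonAction ρ U)
        ∂(Measure.pi fun _ : Literature.MathematicalPhysics.QuantumFieldTheory.Edge 4 S => haarProbability G) =
      Real.exp (-β * ((Nc : ℝ) * Fintype.card (Plaquette 4 S))) *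
        ∫ Z : ZMod S → LayerCfg S S G, F (layerAssembleU Z) * ∏ t : ZMod S, stepKernelU ρ β (Z t) (Z (t + 1))
          ∂(Measure.pi fun _ => layerHaar S S G) := by
  rw [← integral_const_mul, ← (measurePreserving_layerEquivU (S := S) (G := G) hS).integral_comp']
  refine integral_congr_ae (ae_of_all _ fun U => ?_)
  simp only [layerEquivU_apply, layerAssembleU_layerReadU hS, exp_neg_mul_wilsonAction_eq_prod_stepKernelU ρ hS]
  ring

/-- The partition function: `∫ exp(−β S) dHaar = exp(−β N_c #plaq) · diagCyclicTraceU ρ β S`. -/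
theorem integral_exp_neg_mul_wilsonAction_eq (hS : Odd S) :
    ∫ U, Real.exp (-β * wilsonAction ρ U)
        ∂(Measure.pi fun _ : Literature.MathematicalPhysics.QuantumFieldTheory.Edge 4 S => haarProbability G) =
      Real.exp (-β * ((Nc : ℝ) * Fintype.card (Plaquette 4 S))) * diagCyclicTraceU ρ β S (S := S) (G := G) := by
  have h := integral_mul_exp_neg_mul_wilsonAction_eq ρ β hS (fun _ => (1 : ℝ))
  simp only [one_mul] at h
  rw [h, diagCyclicTraceU]

omit [NeZero S] [CompactSpace G] [MeasurableSpace G] [BorelSpace G] in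
/-- Wilson's action is continuous (continuous `ρ`). -/
theorem continuous_wilsonAction' (hρ : Continuous ρ) [NeZero S] :
    Continuous (wilsonAction (d := 4) (L := S) (G := G) ρ) := by
  unfold wilsonAction plaquetteHolonomy
  refine continuous_finsetSum _ fun p _ => continuous_const.sub ((continuous_trace_re ρ hρ).comp ?_)
  fun_prop

variable [SecondCountableTopology G]

/-- **`Z_S = Tr A^S > 0`** at kernel level: the `S`-fold cyclic trace of the symmetric-chart kernel is positive
(it is `exp(β N_c #plaq)` times Wilson's partition function). -/
theorem diagCyclicTraceU_side_pos (hS : Odd S) (hρ : Continuous ρ) : 0 < diagCyclicTraceU ρ β S (S := S) (G := G) := by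
  have hZ : 0 < ∫ U, Real.exp (-β * wilsonAction ρ U)
      ∂(Measure.pi fun _ : Literature.MathematicalPhysics.QuantumFieldTheory.Edge 4 S => haarProbability G) := by
    refine integral_exp_pos ?_
    obtain ⟨C, hC⟩ := (isCompact_univ.image
      (Real.continuous_exp.comp (continuous_const.mul (continuous_wilsonAction' ρ hρ)) :
        Continuous fun U : GaugeConfig 4 S G => Real.exp (-β * wilsonAction ρ U))).isBounded.bddAbove
    refine Integrable.of_bound
      ((Real.measurable_exp.comp ((measurable_wilsonAction ρ hρ).const_mul _)).aestronglyMeasurable) C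
      (ae_of_all _ fun U => ?_)
    rw [Real.norm_of_nonneg (Real.exp_pos _).le]
    exact hC ⟨U, Set.mem_univ _, rfl⟩
  rw [integral_exp_neg_mul_wilsonAction_eq ρ β hS] at hZ
  exact pos_of_mul_pos_right hZ (Real.exp_pos _).le

/-- **Wilson's measure on the odd torus through the symmetric-chart kernel**:
`∫ F dμ_{Wilson} = (∫ F(assembled layers) ∏_v K_u(Z_v, Z_{v+1}) dHaar) / Tr K_u^S`. -/
theorem integral_wilsonMeasure_eq_diagCyclicU (hS : Odd S) (hρ : Continuous ρ) (F : GaugeConfig 4 S G → ℝ) :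
    ∫ U, F U ∂(wilsonMeasure ρ β) =
      (∫ Z : ZMod S → LayerCfg S S G, F (layerAssembleU Z) * ∏ t : ZMod S, stepKernelU ρ β (Z t) (Z (t + 1))
          ∂(Measure.pi fun _ => layerHaar S S G)) / diagCyclicTraceU ρ β S (S := S) (G := G) := by
  rw [integral_wilsonMeasure_eq_div'' ρ β hρ, integral_mul_exp_neg_mul_wilsonAction_eq ρ β hS,
    integral_exp_neg_mul_wilsonAction_eq ρ β hS, mul_div_mul_left _ _ (Real.exp_pos _).ne']

/-- **The scheme's lattice `n`-point functions through the symmetric-chart kernel** (the scheme's torus has ODD side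
`2 L_k + 1`): `latticeSchwinger` at step `k` is the normalised cyclic `S_k`-fold integral of `K_u` with the product of
smeared fields inserted. -/
theorem latticeSchwinger_eq_diagCyclicU (hρ : Continuous ρ) {ι : Type} (sch : SpeciesScheme ι)
    (obs : ι → LGConfig 4 G → ℝ) (k n : ℕ) (σ : Fin n → ι) (f : Fin n → SchwartzMap (EuclideanSpace ℝ (Fin 4)) ℝ) :
    latticeSchwinger ρ sch obs k n σ f =
      (∫ Z : ZMod (sch.side k) → LayerCfg (sch.side k) (sch.side k) G,
          (∏ i, smearedLatticeField (obs (σ i)) (Literature.Probability.LatticeModels.box 4 (sch.L k)) (sch.a k)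
              (sch.c (σ i) k) (sch.m (σ i) k) (f i) (torusLift (sch.side k) (layerAssembleU Z))) *
            ∏ t : ZMod (sch.side k), stepKernelU ρ (sch.β k) (Z t) (Z (t + 1))
          ∂(Measure.pi fun _ => layerHaar (sch.side k) (sch.side k) G)) /
        diagCyclicTraceU ρ (sch.β k) (sch.side k) (S := sch.side k) (G := G) := by
  unfold latticeSchwinger
  exact integral_wilsonMeasure_eq_diagCyclicU ρ (sch.β k) ⟨sch.L k, rfl⟩ hρ _

end UCyclic



/-! ## §11 The swap `x₀ ↔ x₁` in the symmetric chart: FIBREWISE; the two half steps and their Θ-pseudo-symmetry -/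

section Swap

variable {S : ℕ}

/-- **The swap is fibrewise in the symmetric chart**: `x₀ ↔ x₁` acts on `(v, (u, y, z))` by `v ↦ −v` only. -/
theorem lcSite_sitePerm_swap (x : Literature.MathematicalPhysics.QuantumFieldTheory.Site 4 S) :
    lcSite (sitePerm (Equiv.swap 0 1) x) = (-(lcSite x).1, (lcSite x).2) := by
  simp only [lcSite, sitePerm_apply, Equiv.symm_swap, Equiv.swap_apply_left, Equiv.swap_apply_right, neg_sub,
    Prod.mk.injEq, true_and]
  have h2 : (Equiv.swap (0 : Fin 4) 1) 2 = 2 := by decide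
  have h3 : (Equiv.swap (0 : Fin 4) 1) 3 = 3 := by decide
  rw [h2, h3, add_comm]
  exact ⟨rfl, rfl, rfl⟩

/-- The swap on chart points: `swap (lcInv (v, s)) = lcInv (−v, s)` (odd `S`). -/
theorem sitePerm_swap_lcInv (hS : Odd S) (v : ZMod S) (s : SlabSite S S) :
    sitePerm (Equiv.swap 0 1) (lcInv (v, s)) = lcInv (-v, s) := by
  have h := lcSite_sitePerm_swap (lcInv (v, s))
  rw [lcSite_lcInv hS] at h
  rw [← lcInv_lcSite hS (sitePerm (Equiv.swap 0 1) (lcInv (v, s))), h]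

variable {G : Type*}

/-- The bond-label involution `Θ` of a half layer: `e₀`-bond label `0 ↔` `e₁`-bond label `1` (the swap exchanges the two
bond directions and fixes the in-slab directions). -/
def thetaHalf (Y : HalfCfg S S G) : HalfCfg S S G := fun p => Y (p.1, Equiv.swap 0 1 p.2)

/-- `Θ` is an involution. -/
theorem thetaHalf_thetaHalf (Y : HalfCfg S S G) : thetaHalf (thetaHalf Y) = Y := by
  funext ⟨s, i⟩
  simp [thetaHalf, Equiv.swap_apply_self]

variable [MeasurableSpace G]

/-- **The swapped configuration read in layers, in-slab half**: `X_v(swap U) = X_{−v}(U)` (odd `S`). -/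
theorem inslab_layerReadU_swap (hS : Odd S) (U : GaugeConfig 4 S G) (t : ZMod S) :
    inslab (layerReadU (configPerm (Equiv.swap 0 1) U) t) = inslab (layerReadU U (-t)) := by
  funext ⟨s, i⟩
  fin_cases i <;>
    simp [inslab, layerReadU, configPerm_apply, Equiv.symm_swap, sitePerm_swap_lcInv hS,
      show (Equiv.swap (0 : Fin 4) 1) 2 = 2 from by decide, show (Equiv.swap (0 : Fin 4) 1) 3 = 3 from by decide]

/-- **The swapped configuration read in layers, bond half**: `Y_{v−½}(swap U) = Θ Y_{½−v}(U)`, i.e.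
`bonds (Z_v (swap U)) = Θ (bonds (Z_{1−v} U))` (odd `S`): the swap exchanges the two half-layer TYPES around slab `0`
and acts on bond labels by `Θ` — FIBREWISE, with no slab shift (this is what the symmetric chart buys). -/
theorem bonds_layerReadU_swap (hS : Odd S) (U : GaugeConfig 4 S G) (t : ZMod S) :
    bonds (layerReadU (configPerm (Equiv.swap 0 1) U) t) = thetaHalf (bonds (layerReadU U (1 - t))) := by
  funext ⟨s, i⟩
  fin_cases i
  · simp [bonds, thetaHalf, layerReadU, configPerm_apply, Equiv.symm_swap, sitePerm_swap_lcInv hS, neg_sub]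
  · simp [bonds, thetaHalf, layerReadU, configPerm_apply, Equiv.symm_swap, sitePerm_swap_lcInv hS]

end Swap

section UHalfSteps

variable {S : ℕ} [NeZero S] {G : Type*} [Group G] {Nc : ℕ} (ρ : G →* Matrix (Fin Nc) (Fin Nc) ℂ)

/-- **The even half step in the symmetric chart** (window `Y_{v−½}, X_v, Y_{v+½}`): the `(0,1)` diamonds
`Y'(u,0) Y'(u+1,1) Y(u+1,0)⁻¹ Y(u,1)⁻¹` plus the in-slab `(2,3)` plaquettes of `X_v`. -/
def evenActionU (Y X Y' : HalfCfg S S G) : ℝ :=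
  ∑ s : SlabSite S S,
    ((ρ (Y' (s, 0) * Y' (s + slabStep 1, 1) * (Y (s + slabStep 1, 0))⁻¹ * (Y (s, 1))⁻¹)).trace.re +
      (ρ (X (s, 0) * X (s + slabStep 2, 1) * (X (s + slabStep 3, 0))⁻¹ * (X (s, 1))⁻¹)).trace.re)

/-- **The odd half step in the symmetric chart** (window `X_v, Y_{v+½}, X_{v+1}`): the `(0,2),(0,3)` plaquettes based in
slab `v` and the `(1,2),(1,3)` plaquettes based in slab `v+1`. -/
def oddActionU (X Y' X' : HalfCfg S S G) : ℝ :=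
  ∑ s : SlabSite S S,
    ((ρ (Y' (s, 0) * X' (s + slabStep 1, 0) * (Y' (s + slabStep 2, 0))⁻¹ * (X (s, 0))⁻¹)).trace.re +
      (ρ (Y' (s, 0) * X' (s + slabStep 1, 1) * (Y' (s + slabStep 3, 0))⁻¹ * (X (s, 1))⁻¹)).trace.re +
      (ρ (Y' (s, 1) * X (s + slabStep 1, 0) * (Y' (s + slabStep 2, 1))⁻¹ * (X' (s, 0))⁻¹)).trace.re +
      (ρ (Y' (s, 1) * X (s + slabStep 1, 1) * (Y' (s + slabStep 3, 1))⁻¹ * (X' (s, 1))⁻¹)).trace.re)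

/-- **One symmetric-chart step = even half step + odd half step.** -/
theorem stepActionU_eq_even_add_odd (Z Z' : LayerCfg S S G) :
    stepActionU ρ Z Z' =
      evenActionU ρ (bonds Z) (inslab Z) (bonds Z') + oddActionU ρ (inslab Z) (bonds Z') (inslab Z') := by
  unfold stepActionU evenActionU oddActionU
  rw [← Finset.sum_add_distrib]
  refine Finset.sum_congr rfl fun s _ => ?_
  rw [sum_fin4_lt]
  simp only [stepPlaqU, bonds, inslab, Matrix.cons_val_zero, Matrix.cons_val_one, Matrix.cons_val]
  ring

/-- The symmetric-chart kernel is the product of the two half-step weights. -/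
theorem stepKernelU_eq_even_mul_odd (β : ℝ) (Z Z' : LayerCfg S S G) :
    stepKernelU ρ β Z Z' = Real.exp (β * evenActionU ρ (bonds Z) (inslab Z) (bonds Z')) *
      Real.exp (β * oddActionU ρ (inslab Z) (bonds Z') (inslab Z')) := by
  rw [stepKernelU, stepActionU_eq_even_add_odd, mul_add, Real.exp_add]

/-- **Θ-pseudo-symmetry of the ODD half step** (`𝓑ᵀ = Θ 𝓑 Θ` of the card, exactly, no hypothesis on `ρ`):
reversing the window and twisting the bond layer by `Θ` leaves the odd action invariant. -/
theorem oddActionU_reverse (X Y' X' : HalfCfg S S G) :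
    oddActionU ρ X' (thetaHalf Y') X = oddActionU ρ X Y' X' := by
  unfold oddActionU thetaHalf
  refine Finset.sum_congr rfl fun s _ => ?_
  simp only [Equiv.swap_apply_left, Equiv.swap_apply_right]
  ring

/-- The diamond of the `(0,1)` cut at slab coordinate `u`: `D_u(W) = W(u,1) · W(u+1,0)` (the two-link path across the
mirror slab). -/
def diamond (W : HalfCfg S S G) (s : SlabSite S S) : G := W (s, 1) * W (s + slabStep 1, 0)

/-- **The Θ-twisted even half step is a SCHUR CUT**: `even(Y, X, ΘY'')` couples the two bond layers only through
`Re tr ρ(D_u(Y'') · D_u(Y)⁻¹)` — a function of positive type of the pair of diamonds for `β ≥ 0`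
(`exp(β Re tr ρ(g h⁻¹))` is positive definite; `Literature/Analysis/OperatorTheory/ExpInnerProductKernelPositivity`),
which is the operator statement `B̂ = Θ𝓑 ⪰ 0` of the card at kernel level. -/
theorem evenActionU_thetaHalf (Y X Y'' : HalfCfg S S G) :
    evenActionU ρ Y X (thetaHalf Y'') = ∑ s : SlabSite S S,
      ((ρ (diamond Y'' s * (diamond Y s)⁻¹)).trace.re +
        (ρ (X (s, 0) * X (s + slabStep 2, 1) * (X (s + slabStep 3, 0))⁻¹ * (X (s, 1))⁻¹)).trace.re) := by
  unfold evenActionU thetaHalf diamond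
  refine Finset.sum_congr rfl fun s _ => ?_
  simp only [Equiv.swap_apply_left, Equiv.swap_apply_right, mul_inv_rev, mul_assoc]

variable [TopologicalSpace G] [IsTopologicalGroup G] [CompactSpace G]

/-- **Θ-pseudo-symmetry of the EVEN half step** (`𝒜ᵀ = Θ 𝒜 Θ` of the card): reversing the window and twisting both bond
layers by `Θ` leaves the even action invariant — the reversed diamond is the INVERSE holonomy, and
`Re tr ρ(g⁻¹) = Re tr ρ(g)` for a continuous representation of a compact group. -/
theorem evenActionU_reverse (hρ : Continuous ρ) (Y X Y'' : HalfCfg S S G) :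
    evenActionU ρ (thetaHalf Y'') X (thetaHalf Y) = evenActionU ρ Y X Y'' := by
  unfold evenActionU thetaHalf
  refine Finset.sum_congr rfl fun s _ => ?_
  simp only [Equiv.swap_apply_left, Equiv.swap_apply_right]
  congr 1
  rw [← Literature.RepresentationTheory.CompactGroups.CompactGroup.re_trace_map_inv ρ hρ]
  congr 3
  simp only [mul_inv_rev, inv_inv, mul_assoc]

end UHalfSteps

end Summit.QuantumFields.YangMills.Cruxes.DiagonalMirrorRPR.SignTwistedDiagonalTrace.WilsonDiagonal

end
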